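import Mathlib
import HarnessLib
import Literature.Analysis.FluidPDE.SelfSimilar
import Literature.Analysis.FluidPDE.LocalTypeI
import Literature.Analysis.FluidPDE.VectorCalculus
import Literature.Analysis.FluidPDE.OseenMildUniqueness
import Literature.Analysis.FluidPDE.OseenZoomCovariance
import Literature.Analysis.FluidPDE.AxisymmetricEuler
import Literature.Analysis.FluidPDE.AxisymmetricVorticityTransport
import Literature.Analysis.UnboundedOperators.HeatKernel
import Summits.NavierStokesRegularity.NavierStokesRegularity.Theorems.LocalSineTubeDoorProfileAlignedWindowRigidityAncient
import Summits.NavierStokesRegularity.NavierStokesRegularity.Theorems.LocalSineTubeDoorProfileAlignedWindowRigidity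
import Summits.NavierStokesRegularity.NavierStokesRegularity.Theorems.PoloidalWindowDoorPoloidalWindowRigidityRotate
import Summits.NavierStokesRegularity.NavierStokesRegularity.Theorems.PoloidalWindowDoorPoloidalWindowRigidityFlat
import Summits.NavierStokesRegularity.NavierStokesRegularity.Theorems.PoloidalWindowDoorPoloidalWindowRigidityFlatHorizontal
import Summits.NavierStokesRegularity.NavierStokesRegularity.Theorems.PoloidalWindowDoorPoloidalWindowRigidityAxisymmetric
import Summits.NavierStokesRegularity.NavierStokesRegularity.Theorems.PoloidalWindowDoorPoloidalWindowRigidityDegenerate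

/-!
# Route `PoloidalWindowDoor` (staged, nsreg-p1), crux `PoloidalWindowRigidity` — degeneracy on ONE slice already
# settles the stub: symmetry of a single slice propagates to every slice

Cell ns-regularity-ideate, seat p6 (route-directed support; land `--supports <PoloidalWindowRigidity item>` once the
route is born). The settled strata staged so far (`…Degenerate` (R8-f) vertically rigid, `…Flat`/`…FlatHorizontal`
(R8-d) flat in a horizontal direction, `…Axisymmetric` axisymmetric about a vertical axis) assume the degeneracy on
EVERY slice `s < 0`. For a profile of the route's Type-I class a spatial symmetry of ONE slice is a symmetry of ALL
slices — FORWARD by bounded Oseen-mild uniqueness (tree `oseenMild_bounded_unique`: the conjugated / translated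
field solves the same integral equation from the same slice), BACKWARD by real-analyticity in time and the
identity theorem on `(−∞,0)` (tree `…Ancient.analyticOnNhd_uncurry`, the move of `…Ancient.translate_eq_backward`):

* `conj_eq_forward`, `conj_eq_backward`, `conj_eq_of_slice` — invariance under the conjugation `v(t) ↦ L ∘ v(t) ∘ L⁻¹`
  by a linear isometry `L` of `ℝ³` propagates from one slice to all (caloric and Duhamel covariance, tree
  `heatExtension_conj_linearIsometryEquiv` / `oseenDuhamel_symm_conj_linearIsometryEquiv`);
* `translate_eq_of_slice` — the same for translation invariance along a vector (tree `translate_eq_forward/backward`);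
* `eq_zero_of_translate_eq_slice` — ONE slice invariant under the translations along some `e ≠ 0` ⇒ `v ≡ 0` ((N₁));
* `eq_zero_of_vertRigid_slice` — (R8-f) on ONE slice: `(∂₃v)₀ = (∂₃v)₁ ≡ 0` at one `s < 0` ⇒ `v ≡ 0`;
* `eq_zero_of_flat_slice` — (R8-d) on ONE slice: `ω₃ ≡ 0` and `⟪Dv a, e₃⟫ ≡ 0` at one `s < 0` for one horizontal
  `a ≠ 0` ⇒ `v ≡ 0`;
* `isAxisymmetric_of_slice` — axisymmetry about the vertical axis through `c` at one `s < 0` ⇒ at every `t < 0`;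
  `eq_zero_of_axisymmetric_slice` — with `ω₃ ≡ 0` on all slices, such a profile vanishes (KNSS Thm 5.2 stratum).

So the residue of K2 may assume that EVERY slice is non-degenerate (see `…Sharper`/the lead's reshape).

WHAT THIS IS NOT: not a claim about Navier–Stokes regularity and not the open stub — one-slice forms of settled strata,
for a STAGED door route (bears_on LADDER-NS N0, rung N0-LocalTubeDoorPoloidal).
-/

noncomputable section

-- the summit and its single sub-problem share the name (CONVENTIONS §1), as in every Theorems file
set_option linter.dupNamespace false

namespace Summit.NavierStokesRegularity.NavierStokesRegularity.Theorems.PoloidalWindowDoorPoloidalWindowRigidityOneSlice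

open MeasureTheory Set Function Filter Topology TopologicalSpace Metric
open scoped RealInnerProductSpace InnerProductSpace
open Literature.Analysis Literature.Analysis.FluidPDE
open Summit.NavierStokesRegularity.NavierStokesRegularity.Theorems.LocalSineTubeDoorProfileAlignedWindowRigidityAncient
open Summit.NavierStokesRegularity.NavierStokesRegularity.Theorems.LocalSineTubeDoorProfileAlignedWindowRigidity
open Summit.NavierStokesRegularity.NavierStokesRegularity.Theorems.PoloidalWindowDoorPoloidalWindowRigidityRotate
open Summit.NavierStokesRegularity.NavierStokesRegularity.Theorems.PoloidalWindowDoorPoloidalWindowRigidityFlat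
open Summit.NavierStokesRegularity.NavierStokesRegularity.Theorems.PoloidalWindowDoorPoloidalWindowRigidityFlatHorizontal
open Summit.NavierStokesRegularity.NavierStokesRegularity.Theorems.PoloidalWindowDoorPoloidalWindowRigidityAxisymmetric
open Summit.NavierStokesRegularity.NavierStokesRegularity.Theorems.PoloidalWindowDoorPoloidalWindowRigidityDegenerate

variable {C : ℝ} {v : ℝ → EuclideanSpace ℝ (Fin 3) → EuclideanSpace ℝ (Fin 3)}

/-! ### symmetry under a linear isometry propagates from one slice -/

/-- **Conjugation invariance propagates FORWARD** (bounded Oseen-mild uniqueness): if the slice `v(s)` is invariant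
under `w ↦ L ∘ w ∘ L⁻¹` for a linear isometry `L` of `ℝ³`, so is every later slice `v(t)`, `s ≤ t < 0` — the
conjugated field solves the same Oseen integral equation from the same slice (caloric and Duhamel covariance). -/
theorem conj_eq_forward (hcont : ContinuousOn (uncurry v) (Iio (0 : ℝ) ×ˢ univ))
    (hbdd : ∀ δ : ℝ, 0 < δ → ∃ B : ℝ, ∀ t < -δ, ∀ y : EuclideanSpace ℝ (Fin 3), ‖v t y‖ ≤ B)
    (hmild : ∀ s t : ℝ, s < t → t < 0 → ∀ y,
      v t y = UnboundedOperators.heatExtension (v s) (t - s) y - oseenDuhamel 1 s v v t y)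
    (L : EuclideanSpace ℝ (Fin 3) ≃ₗᵢ[ℝ] EuclideanSpace ℝ (Fin 3)) {s : ℝ}
    (h : ∀ y, L (v s (L.symm y)) = v s y) :
    ∀ t, s ≤ t → t < 0 → ∀ y, L (v t (L.symm y)) = v t y := by
  intro t hst ht0
  rcases hst.eq_or_lt with rfl | hst'
  · exact h
  intro y
  set w : ℝ → EuclideanSpace ℝ (Fin 3) → EuclideanSpace ℝ (Fin 3) := fun τ x => L (v τ (L.symm x)) with hw
  obtain ⟨T₂, htT₂, hT₂0⟩ : ∃ T₂ : ℝ, t < T₂ ∧ T₂ < 0 := ⟨t / 2, by linarith, by linarith⟩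
  obtain ⟨B, hB⟩ := hbdd (-T₂) (by linarith)
  have hB' : ∀ τ ∈ Ioo s T₂, ∀ y, ‖v τ y‖ ≤ max B 0 := fun τ hτ y =>
    (hB τ (by linarith [hτ.2]) y).trans (le_max_left _ _)
  have hsub : Ioo s T₂ ×ˢ (univ : Set (EuclideanSpace ℝ (Fin 3))) ⊆ Iio 0 ×ˢ univ :=
    prod_mono (fun τ hτ => hτ.2.trans hT₂0) Subset.rfl
  have hum : AEStronglyMeasurable (uncurry v) (volume.restrict (Ioo s T₂ ×ˢ univ)) :=
    (hcont.mono hsub).aestronglyMeasurable (measurableSet_Ioo.prod MeasurableSet.univ)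
  have hcontw : ContinuousOn (uncurry w) (Ioo s T₂ ×ˢ univ) := by
    have h1 : ContinuousOn (fun z : ℝ × EuclideanSpace ℝ (Fin 3) => (z.1, L.symm z.2)) (Ioo s T₂ ×ˢ univ) :=
      (continuous_fst.prodMk (L.symm.continuous.comp continuous_snd)).continuousOn
    have h2 : MapsTo (fun z : ℝ × EuclideanSpace ℝ (Fin 3) => (z.1, L.symm z.2)) (Ioo s T₂ ×ˢ univ)
        (Iio (0 : ℝ) ×ˢ univ) := fun z hz =>
      mem_prod.2 ⟨(mem_prod.1 hz).1.2.trans hT₂0, mem_univ _⟩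
    exact L.continuous.comp_continuousOn (hcont.comp h1 h2)
  have hwm : AEStronglyMeasurable (uncurry w) (volume.restrict (Ioo s T₂ ×ˢ univ)) :=
    hcontw.aestronglyMeasurable (measurableSet_Ioo.prod MeasurableSet.univ)
  have hwM : ∀ τ ∈ Ioo s T₂, ∀ y, ‖w τ y‖ ≤ max B 0 := fun τ hτ y => by
    simp only [hw, L.norm_map]
    exact hB' τ hτ (L.symm y)
  have hu : ∀ τ ∈ Ioo s T₂, v τ =ᵐ[volume] fun x =>
      UnboundedOperators.heatExtension (v s) (τ - s) x - oseenDuhamel 1 s v v τ x :=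
    fun τ hτ => Eventually.of_forall fun x => hmild s τ hτ.1 (hτ.2.trans hT₂0) x
  have hslice : (fun y => L (v s (L.symm y))) = v s := funext h
  have hv₂ : ∀ τ ∈ Ioo s T₂, w τ =ᵐ[volume] fun x =>
      UnboundedOperators.heatExtension (v s) (τ - s) x - oseenDuhamel 1 s w w τ x := by
    intro τ hτ
    refine Eventually.of_forall fun x => ?_
    have h1 : UnboundedOperators.heatExtension (v s) (τ - s) x =
        L (UnboundedOperators.heatExtension (v s) (τ - s) (L.symm x)) := by
      rw [← heatExtension_conj_linearIsometryEquiv L (v s) (τ - s) x, hslice]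
    have h2 : oseenDuhamel 1 s w w τ x = L (oseenDuhamel 1 s v v τ (L.symm x)) := by
      have h2' := oseenDuhamel_symm_conj_linearIsometryEquiv L.symm 1 s v v τ x
      simp only [LinearIsometryEquiv.symm_symm] at h2'
      exact h2'
    show L (v τ (L.symm x)) =
      UnboundedOperators.heatExtension (v s) (τ - s) x - oseenDuhamel 1 s w w τ x
    rw [h1, h2, hmild s τ hτ.1 (hτ.2.trans hT₂0) (L.symm x), map_sub]
  have hae := oseenMild_bounded_unique
    (U := fun τ x => UnboundedOperators.heatExtension (v s) (τ - s) x)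
    one_pos (le_max_right B 0) hum hwm hB' hwM hu hv₂
  have ht : t ∈ Ioo s T₂ := ⟨hst', htT₂⟩
  have hg : Continuous (w t) :=
    L.continuous.comp ((continuous_slice hcont ht0).comp L.symm.continuous)
  have heq : v t = w t := ((continuous_slice hcont ht0).ae_eq_iff_eq volume hg).1 (hae t ht)
  exact (congrFun heq y).symm

/-- **Conjugation invariance propagates BACKWARD** (real-analyticity in time + identity theorem on `(−∞,0)`). -/
theorem conj_eq_backward (hcont : ContinuousOn (uncurry v) (Iio (0 : ℝ) ×ˢ univ))
    (hbdd : ∀ δ : ℝ, 0 < δ → ∃ B : ℝ, ∀ t < -δ, ∀ y : EuclideanSpace ℝ (Fin 3), ‖v t y‖ ≤ B)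
    (hmild : ∀ s t : ℝ, s < t → t < 0 → ∀ y,
      v t y = UnboundedOperators.heatExtension (v s) (t - s) y - oseenDuhamel 1 s v v t y)
    (L : EuclideanSpace ℝ (Fin 3) ≃ₗᵢ[ℝ] EuclideanSpace ℝ (Fin 3)) {s : ℝ} (hs : s < 0)
    (h : ∀ t, s ≤ t → t < 0 → ∀ y, L (v t (L.symm y)) = v t y) :
    ∀ t < 0, ∀ y, L (v t (L.symm y)) = v t y := by
  intro t ht y
  have hg : AnalyticOnNhd ℝ (fun τ => L (v τ (L.symm y)) - v τ y) (Iio 0) := by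
    intro τ hτ
    have h1 : AnalyticAt ℝ (uncurry v) (τ, L.symm y) :=
      analyticOnNhd_uncurry hcont hbdd hmild _ (mem_prod.2 ⟨hτ, mem_univ _⟩)
    have h2 : AnalyticAt ℝ (uncurry v) (τ, y) :=
      analyticOnNhd_uncurry hcont hbdd hmild _ (mem_prod.2 ⟨hτ, mem_univ _⟩)
    have hι₁ : AnalyticAt ℝ (fun σ : ℝ => (σ, L.symm y)) τ := analyticAt_id.prod analyticAt_const
    have hι₂ : AnalyticAt ℝ (fun σ : ℝ => (σ, y)) τ := analyticAt_id.prod analyticAt_const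
    have h1' : AnalyticAt ℝ (fun σ => v σ (L.symm y)) τ := h1.comp_of_eq hι₁ rfl
    have h2' : AnalyticAt ℝ (fun σ => v σ y) τ := h2.comp_of_eq hι₂ rfl
    have hL : AnalyticAt ℝ (L : EuclideanSpace ℝ (Fin 3) → EuclideanSpace ℝ (Fin 3)) (v τ (L.symm y)) :=
      (L.toContinuousLinearEquiv : EuclideanSpace ℝ (Fin 3) →L[ℝ] EuclideanSpace ℝ (Fin 3)).analyticAt _
    have h3 : AnalyticAt ℝ (fun σ => L (v σ (L.symm y))) τ := hL.comp_of_eq h1' rfl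
    exact h3.sub h2'
  have hs2 : s / 2 ∈ Iio (0 : ℝ) := by
    simp only [mem_Iio]
    linarith
  have hev : (fun τ => L (v τ (L.symm y)) - v τ y) =ᶠ[𝓝 (s / 2)] 0 := by
    filter_upwards [isOpen_Ioo.mem_nhds (show s / 2 ∈ Ioo s 0 from ⟨by linarith, by linarith⟩)]
      with τ hτ
    simp only [Pi.zero_apply, sub_eq_zero]
    exact h τ hτ.1.le hτ.2 y
  have := hg.eqOn_zero_of_preconnected_of_eventuallyEq_zero isPreconnected_Iio hs2 hev ht
  simpa [sub_eq_zero] using this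

/-- **A linear-isometry symmetry of ONE slice is a symmetry of EVERY slice** of an Oseen-ancient field. -/
theorem conj_eq_of_slice (hcont : ContinuousOn (uncurry v) (Iio (0 : ℝ) ×ˢ univ))
    (hbdd : ∀ δ : ℝ, 0 < δ → ∃ B : ℝ, ∀ t < -δ, ∀ y : EuclideanSpace ℝ (Fin 3), ‖v t y‖ ≤ B)
    (hmild : ∀ s t : ℝ, s < t → t < 0 → ∀ y,
      v t y = UnboundedOperators.heatExtension (v s) (t - s) y - oseenDuhamel 1 s v v t y)
    (L : EuclideanSpace ℝ (Fin 3) ≃ₗᵢ[ℝ] EuclideanSpace ℝ (Fin 3)) {s : ℝ} (hs : s < 0)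
    (h : ∀ y, L (v s (L.symm y)) = v s y) : ∀ t < 0, ∀ y, L (v t (L.symm y)) = v t y :=
  conj_eq_backward hcont hbdd hmild L hs (conj_eq_forward hcont hbdd hmild L h)

/-- **Translation invariance of ONE slice is translation invariance of EVERY slice** (tree
`translate_eq_forward` + `translate_eq_backward`). -/
theorem translate_eq_of_slice (hcont : ContinuousOn (uncurry v) (Iio (0 : ℝ) ×ˢ univ))
    (hbdd : ∀ δ : ℝ, 0 < δ → ∃ B : ℝ, ∀ t < -δ, ∀ y : EuclideanSpace ℝ (Fin 3), ‖v t y‖ ≤ B)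
    (hmild : ∀ s t : ℝ, s < t → t < 0 → ∀ y,
      v t y = UnboundedOperators.heatExtension (v s) (t - s) y - oseenDuhamel 1 s v v t y)
    {s : ℝ} (hs : s < 0) {e : EuclideanSpace ℝ (Fin 3)} (h : ∀ (y : EuclideanSpace ℝ (Fin 3)) (l : ℝ), v s (y + l • e) = v s y) :
    ∀ t < 0, ∀ (y : EuclideanSpace ℝ (Fin 3)) (l : ℝ), v t (y + l • e) = v t y :=
  translate_eq_backward hcont hbdd hmild hs (translate_eq_forward hcont hbdd hmild h)

/-- **Translation invariance of ONE slice along ANY direction `e ≠ 0` ⇒ trivial** ((N₁) ancient planar Liouville with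
the Type-I rate, tree `…LocalSineTubeDoorProfileAlignedWindowRigidity.eq_zero_of_translate_eq`, after `translate_eq_of_slice`). -/
theorem eq_zero_of_translate_eq_slice (hrate : HasTypeITimeDecay C v)
    (hcont : ContinuousOn (uncurry v) (Iio (0 : ℝ) ×ˢ univ))
    (hmild : ∀ s t : ℝ, s < t → t < 0 → ∀ x,
      v t x = UnboundedOperators.heatExtension (v s) (t - s) x - oseenDuhamel 1 s v v t x)
    (hdiv : ∀ t < 0, VectorCalculus.IsDivFree (v t)) {s : ℝ} (hs : s < 0)
    {e : EuclideanSpace ℝ (Fin 3)} (he : e ≠ 0) (h : ∀ (y : EuclideanSpace ℝ (Fin 3)) (l : ℝ), v s (y + l • e) = v s y) :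
    ∀ t < 0, ∀ x, v t x = 0 :=
  eq_zero_of_translate_eq hrate hcont hmild hdiv he
    (translate_eq_of_slice hcont (bdd_of_hasTypeITimeDecay hrate) hmild hs h)

/-- **Translation invariance of one slice along any direction**: not backward-singular. -/
theorem nonflatLiouville_of_translate_eq_slice (hrate : HasTypeITimeDecay C v)
    (hcont : ContinuousOn (uncurry v) (Iio (0 : ℝ) ×ˢ univ))
    (hmild : ∀ s t : ℝ, s < t → t < 0 → ∀ x,
      v t x = UnboundedOperators.heatExtension (v s) (t - s) x - oseenDuhamel 1 s v v t x)
    (hdiv : ∀ t < 0, VectorCalculus.IsDivFree (v t)) {s : ℝ} (hs : s < 0)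
    {e : EuclideanSpace ℝ (Fin 3)} (he : e ≠ 0) (h : ∀ (y : EuclideanSpace ℝ (Fin 3)) (l : ℝ), v s (y + l • e) = v s y) :
    ¬ IsBackwardSingularPoint v 0 :=
  not_backwardSingular_of_zero (eq_zero_of_translate_eq_slice hrate hcont hmild hdiv hs he h)

/-! ### (R8-f) vertically rigid on one slice -/

/-- **(R8-f) on ONE slice.** A profile of the class whose horizontal velocity is rigid in the vertical direction on
ONE slice `s < 0` (`(∂₃v)₀ = (∂₃v)₁ ≡ 0` there) vanishes identically: that slice is invariant under vertical
translations (`translate_eq_of_vertRigid`), hence so is every slice, and (N₁) applies. -/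
theorem eq_zero_of_vertRigid_slice (hrate : HasTypeITimeDecay C v)
    (hcont : ContinuousOn (uncurry v) (Iio (0 : ℝ) ×ˢ univ))
    (hmild : ∀ s t : ℝ, s < t → t < 0 → ∀ x,
      v t x = UnboundedOperators.heatExtension (v s) (t - s) x - oseenDuhamel 1 s v v t x)
    (hdiv : ∀ t < 0, VectorCalculus.IsDivFree (v t)) {s : ℝ} (hs : s < 0)
    (h0 : ∀ y, fderiv ℝ (v s) y (EuclideanSpace.single 2 1) 0 = 0)
    (h1 : ∀ y, fderiv ℝ (v s) y (EuclideanSpace.single 2 1) 1 = 0) : ∀ t < 0, ∀ x, v t x = 0 := by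
  have hbdd := bdd_of_hasTypeITimeDecay hrate
  have hC2 : ContDiff ℝ 2 (v s) := (analyticOnNhd_slice hcont hbdd hmild hs).contDiff
  have hinv : ∀ (y : EuclideanSpace ℝ (Fin 3)) (l : ℝ),
      v s (y + l • (EuclideanSpace.single 2 1 : EuclideanSpace ℝ (Fin 3))) = v s y := fun y l =>
    translate_eq_of_vertRigid hC2 (hdiv s hs) (fun y => hrate s hs y) h0 h1 y l
  have hne : (EuclideanSpace.single 2 1 : EuclideanSpace ℝ (Fin 3)) ≠ 0 := fun h => by
    simpa using congrArg (fun w : EuclideanSpace ℝ (Fin 3) => w 2) h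
  exact eq_zero_of_translate_eq hrate hcont hmild hdiv hne (translate_eq_of_slice hcont hbdd hmild hs hinv)

/-- **(R8-f) on one slice**: not backward-singular. -/
theorem nonflatLiouville_of_vertRigid_slice (hrate : HasTypeITimeDecay C v)
    (hcont : ContinuousOn (uncurry v) (Iio (0 : ℝ) ×ˢ univ))
    (hmild : ∀ s t : ℝ, s < t → t < 0 → ∀ x,
      v t x = UnboundedOperators.heatExtension (v s) (t - s) x - oseenDuhamel 1 s v v t x)
    (hdiv : ∀ t < 0, VectorCalculus.IsDivFree (v t)) {s : ℝ} (hs : s < 0)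
    (h0 : ∀ y, fderiv ℝ (v s) y (EuclideanSpace.single 2 1) 0 = 0)
    (h1 : ∀ y, fderiv ℝ (v s) y (EuclideanSpace.single 2 1) 1 = 0) : ¬ IsBackwardSingularPoint v 0 :=
  not_backwardSingular_of_zero (eq_zero_of_vertRigid_slice hrate hcont hmild hdiv hs h0 h1)

/-! ### (R8-d) flat in a horizontal direction on one slice -/

/-- **(R8-d) on ONE slice, direction `e₀`.** If on ONE slice `s < 0` a profile of the class is poloidal along `e₃`
(`ω₃ ≡ 0`) and `v·e₃` is independent of `x₀` (`(∂₀v)₂ ≡ 0`), it vanishes identically: the slice is invariant under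
translations along `e₀` (`translate_eq_of_flat_poloidal`), hence so is every slice, and (N₁) applies. -/
theorem eq_zero_of_flat_slice_single_zero (hrate : HasTypeITimeDecay C v)
    (hcont : ContinuousOn (uncurry v) (Iio (0 : ℝ) ×ˢ univ))
    (hmild : ∀ s t : ℝ, s < t → t < 0 → ∀ x,
      v t x = UnboundedOperators.heatExtension (v s) (t - s) x - oseenDuhamel 1 s v v t x)
    (hdiv : ∀ t < 0, VectorCalculus.IsDivFree (v t)) {s : ℝ} (hs : s < 0)
    (hpol : ∀ y, ⟪curl (v s) y, EuclideanSpace.single 2 1⟫_ℝ = 0)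
    (hflat : ∀ y, fderiv ℝ (v s) y (EuclideanSpace.single 0 1) 2 = 0) : ∀ t < 0, ∀ x, v t x = 0 := by
  have hbdd := bdd_of_hasTypeITimeDecay hrate
  have hC3 : ContDiff ℝ 3 (v s) := (analyticOnNhd_slice hcont hbdd hmild hs).contDiff
  obtain ⟨B, hB⟩ := hbdd (-s / 2) (by linarith)
  obtain ⟨M', hM'⟩ := exists_fderiv_slice_bound hcont hbdd hmild hs
  have hinv : ∀ (y : EuclideanSpace ℝ (Fin 3)) (l : ℝ),
      v s (y + l • (EuclideanSpace.single 0 1 : EuclideanSpace ℝ (Fin 3))) = v s y := fun y l =>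
    translate_eq_of_flat_poloidal hC3 (hdiv s hs) (fun y => hB s (by linarith) y) hM'
      (fun y => by simpa [EuclideanSpace.inner_single_right] using hpol y) hflat y l
  have hne : (EuclideanSpace.single 0 1 : EuclideanSpace ℝ (Fin 3)) ≠ 0 := fun h0 => by
    simpa using congrArg (fun w : EuclideanSpace ℝ (Fin 3) => w 0) h0
  exact eq_zero_of_translate_eq hrate hcont hmild hdiv hne (translate_eq_of_slice hcont hbdd hmild hs hinv)

/-- **(R8-d) on ONE slice, any horizontal direction.** If on ONE slice `s < 0` a profile of the class is poloidal
along `e₃` and `v·e₃` is independent of some horizontal direction `a ≠ 0` (`⟪a,e₃⟫ = 0`, `⟪Dv(s) a, e₃⟫ ≡ 0`), it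
vanishes identically (conjugate by the reflection fixing `e₃` that takes `a/‖a‖` to `e₀`). -/
theorem eq_zero_of_flat_slice (hrate : HasTypeITimeDecay C v)
    (hcont : ContinuousOn (uncurry v) (Iio (0 : ℝ) ×ˢ univ))
    (hmild : ∀ s t : ℝ, s < t → t < 0 → ∀ x,
      v t x = UnboundedOperators.heatExtension (v s) (t - s) x - oseenDuhamel 1 s v v t x)
    (hdiv : ∀ t < 0, VectorCalculus.IsDivFree (v t)) {s : ℝ} (hs : s < 0)
    (hpol : ∀ y, ⟪curl (v s) y, EuclideanSpace.single 2 1⟫_ℝ = 0)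
    {a : EuclideanSpace ℝ (Fin 3)} (ha : a ≠ 0) (ha3 : ⟪a, EuclideanSpace.single 2 1⟫_ℝ = 0)
    (hflat : ∀ y, ⟪fderiv ℝ (v s) y a, EuclideanSpace.single 2 1⟫_ℝ = 0) : ∀ t < 0, ∀ x, v t x = 0 := by
  obtain ⟨L, hL0, hL2⟩ := exists_linearIsometryEquiv_symm_single_zero_fix_single_two ha ha3
  obtain ⟨hrate', hcont', hmild', hdiv'⟩ := class_conj_linearIsometryEquiv L hrate hcont hmild hdiv
  -- the conjugated profile is poloidal along `e₃ = L⁻¹ e₃` and flat along `e₀ = L (a/‖a‖)` on the slice `s`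
  have hpol' : ∀ y, ⟪curl ((fun t x => L (v t (L.symm x))) s) y, EuclideanSpace.single 2 1⟫_ℝ = 0 := by
    intro y
    refine (inner_curl_conj_linearIsometryEquiv_eq_zero_iff L (v s) y (EuclideanSpace.single 2 1)).2 ?_
    rw [hL2]
    exact hpol (L.symm y)
  have hflat' : ∀ y, fderiv ℝ ((fun t x => L (v t (L.symm x))) s) y (EuclideanSpace.single 0 1) 2 = 0 := by
    intro y
    have hD : fderiv ℝ (fun x => L (v s (L.symm x))) y (EuclideanSpace.single 0 1) =
        L (fderiv ℝ (v s) (L.symm y) (L.symm (EuclideanSpace.single 0 1))) := by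
      rw [fderiv_conj_linearIsometryEquiv]
      rfl
    have h2 : fderiv ℝ (fun x => L (v s (L.symm x))) y (EuclideanSpace.single 0 1) 2 =
        ⟪fderiv ℝ (fun x => L (v s (L.symm x))) y (EuclideanSpace.single 0 1), EuclideanSpace.single 2 1⟫_ℝ := by
      simp [EuclideanSpace.inner_single_right]
    show fderiv ℝ (fun x => L (v s (L.symm x))) y (EuclideanSpace.single 0 1) 2 = 0
    rw [h2, hD, LinearIsometryEquiv.inner_map_eq_flip, hL2, hL0, map_smul, real_inner_smul_left,
      hflat (L.symm y), mul_zero]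
  have hzero := eq_zero_of_flat_slice_single_zero hrate' hcont' hmild' hdiv' hs hpol' hflat'
  intro t ht x
  have h := hzero t ht (L x)
  simp only [LinearIsometryEquiv.symm_apply_apply, LinearIsometryEquiv.map_eq_zero_iff] at h
  exact h

/-- **(R8-d) on one slice**: not backward-singular. -/
theorem nonflatLiouville_of_flat_slice (hrate : HasTypeITimeDecay C v)
    (hcont : ContinuousOn (uncurry v) (Iio (0 : ℝ) ×ˢ univ))
    (hmild : ∀ s t : ℝ, s < t → t < 0 → ∀ x,
      v t x = UnboundedOperators.heatExtension (v s) (t - s) x - oseenDuhamel 1 s v v t x)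
    (hdiv : ∀ t < 0, VectorCalculus.IsDivFree (v t)) {s : ℝ} (hs : s < 0)
    (hpol : ∀ y, ⟪curl (v s) y, EuclideanSpace.single 2 1⟫_ℝ = 0)
    {a : EuclideanSpace ℝ (Fin 3)} (ha : a ≠ 0) (ha3 : ⟪a, EuclideanSpace.single 2 1⟫_ℝ = 0)
    (hflat : ∀ y, ⟪fderiv ℝ (v s) y a, EuclideanSpace.single 2 1⟫_ℝ = 0) : ¬ IsBackwardSingularPoint v 0 :=
  not_backwardSingular_of_zero (eq_zero_of_flat_slice hrate hcont hmild hdiv hs hpol ha ha3 hflat)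

/-! ### axisymmetric about a vertical axis on one slice -/

/-- **Axisymmetry of ONE slice is axisymmetry of EVERY slice.** If the slice `v(s)`, `s < 0`, of a profile of the
class is axisymmetric about the vertical axis through `c`, so is every slice `v(t)`, `t < 0` (conjugation by the
rotations `R_θ` of the translated profile `v(·, · + c)`). -/
theorem isAxisymmetric_of_slice (hrate : HasTypeITimeDecay C v)
    (hcont : ContinuousOn (uncurry v) (Iio (0 : ℝ) ×ˢ univ))
    (hmild : ∀ s t : ℝ, s < t → t < 0 → ∀ x,
      v t x = UnboundedOperators.heatExtension (v s) (t - s) x - oseenDuhamel 1 s v v t x)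
    (hdiv : ∀ t < 0, VectorCalculus.IsDivFree (v t)) (c : EuclideanSpace ℝ (Fin 3)) {s : ℝ} (hs : s < 0)
    (haxi : IsAxisymmetric (fun y => v s (y + c))) : ∀ t < 0, IsAxisymmetric (fun y => v t (y + c)) := by
  obtain ⟨hrate', hcont', hmild', -⟩ := class_translate c hrate hcont hmild hdiv
  have hbdd' := bdd_of_hasTypeITimeDecay hrate'
  intro t ht θ x
  have hslice : ∀ y, rotZLIE θ ((fun t y => v t (y + c)) s ((rotZLIE θ).symm y)) =
      (fun t y => v t (y + c)) s y := fun y => by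
    simp only [rotZLIE_apply, rotZLIE_symm_apply]
    exact haxi.rotZ_apply_rotZ_neg θ y
  have h := conj_eq_of_slice hcont' hbdd' hmild' (rotZLIE θ) hs hslice t ht (rotZ θ x)
  simp only [rotZLIE_apply, rotZLIE_symm_apply] at h
  rw [← rotZ_add, neg_add_cancel, rotZ_zero] at h
  exact h.symm

/-- **The axisymmetric stratum on ONE slice.** A profile of the class, poloidal along `e₃` on every slice, one of
whose slices is axisymmetric about some vertical axis `c + ℝe₃`, vanishes identically (all slices are axisymmetric by
`isAxisymmetric_of_slice`; then `…Axisymmetric.nonflatLiouville_of_axisymmetric_translate`, KNSS Thm 5.2). -/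
theorem eq_zero_of_axisymmetric_slice (hrate : HasTypeITimeDecay C v)
    (hcont : ContinuousOn (uncurry v) (Iio (0 : ℝ) ×ˢ univ))
    (hmild : ∀ s t : ℝ, s < t → t < 0 → ∀ x,
      v t x = UnboundedOperators.heatExtension (v s) (t - s) x - oseenDuhamel 1 s v v t x)
    (hdiv : ∀ t < 0, VectorCalculus.IsDivFree (v t))
    (hpol : ∀ s < 0, ∀ y, ⟪curl (v s) y, EuclideanSpace.single 2 1⟫_ℝ = 0)
    (c : EuclideanSpace ℝ (Fin 3)) {s : ℝ} (hs : s < 0) (haxi : IsAxisymmetric (fun y => v s (y + c))) :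
    ∀ t < 0, ∀ x, v t x = 0 :=
  (nonflatLiouville_of_axisymmetric_translate c hrate hcont hmild hdiv hpol
    (isAxisymmetric_of_slice hrate hcont hmild hdiv c hs haxi)).1

/-- **The axisymmetric stratum on one slice**: not backward-singular. -/
theorem nonflatLiouville_of_axisymmetric_slice (hrate : HasTypeITimeDecay C v)
    (hcont : ContinuousOn (uncurry v) (Iio (0 : ℝ) ×ˢ univ))
    (hmild : ∀ s t : ℝ, s < t → t < 0 → ∀ x,
      v t x = UnboundedOperators.heatExtension (v s) (t - s) x - oseenDuhamel 1 s v v t x)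
    (hdiv : ∀ t < 0, VectorCalculus.IsDivFree (v t))
    (hpol : ∀ s < 0, ∀ y, ⟪curl (v s) y, EuclideanSpace.single 2 1⟫_ℝ = 0)
    (c : EuclideanSpace ℝ (Fin 3)) {s : ℝ} (hs : s < 0) (haxi : IsAxisymmetric (fun y => v s (y + c))) :
    ¬ IsBackwardSingularPoint v 0 :=
  not_backwardSingular_of_zero (eq_zero_of_axisymmetric_slice hrate hcont hmild hdiv hpol c hs haxi)

end Summit.NavierStokesRegularity.NavierStokesRegularity.Theorems.PoloidalWindowDoorPoloidalWindowRigidityOneSlice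

end
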